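import Summits.ValiantsHypothesis.ValiantsHypothesis.Theorems.BarrierLeverResultantKernelSufficesForTransversal
import Summits.ValiantsHypothesis.ValiantsHypothesis.Theorems.BarrierLeverTransversalResultantKernelValuationCertificate

/-!
# Route BarrierLever — CT ⇒ TT ONE HEIGHT (indeed one layout) AT A TIME, and the TT / irreducible-core
# slices from a universal valuation certificate

Cell valiant-natproofs, rung V4, 𝒟-side door (c); prover seat val-np-p7 (g2). `--supports`
stmt-ValiantsHypothesis-19616 (`TransversalMinorsNonsingularOnIrreducibleLayouts`). Closes NO item.

The tree's arrow `ResultantKernel.transversal_of_resultantKernel` (item 19180) takes the GLOBAL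
conjecture CT as hypothesis, although its proof uses CT only for the complemented layout `(u, wᶜ)`
at the same height. This file records the local form, so that height slices of CT — e.g. the ones
produced by ONE universal valuation certificate through
`ResultantKernel.resultantKernel_slice_of_universal_valuation` (a universal tree table exists at
`h = 3`; `h = 4` under verification, kit j267375) — give the corresponding slices of TT (19152) and
hence of the irreducible core (19616) with no appeal to CT at other heights:

* `transversal_layout_of_resultantKernel_layout` — CT for `(u, wᶜ)` ⇒ TT for `(u, w)` (the Cauchy
  matrix `((p_i − q_j)⁻¹)` at a generic point; proof verbatim from item 19180's file);
* `transversal_slice_of_resultantKernel_slice` — CT at height `h` (all `r`) ⇒ TT at height `h`;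
* `transversal_slice_of_universal_valuation` — one valuation certificate with unique optimal
  assignments for every layout pair at height `h` ⇒ TT at height `h`;
* `irreducibleCore_slice_of_universal_valuation` — the same conclusion in the binder shape of item
  19616 at height `h + 1` (its R1/R2-irreducibility hypotheses are simply not needed).

WHAT THIS IS NOT: no certificate is supplied here, so no slice is actually closed; TT/CT/19616 open
for general `h`; nothing on 14610 or `VP ≠ VNP`.
-/

-- layout Summits/ValiantsHypothesis/ValiantsHypothesis forces the duplicated namespace component
set_option linter.dupNamespace false

open MvPolynomial Finset

namespace Summit.ValiantsHypothesis.ValiantsHypothesis.Theorems.BarrierLever.ResultantKernel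

/-! ## 1. CT ⇒ TT for one layout -/

/-- **CT for the complemented layout `(u, wᶜ)` ⇒ TT for `(u, w)`** (same height, same `r`;
injectivity of the layout is not even needed), with
the Cauchy matrix `H = ((p_i − q_j)⁻¹)` at a generic point `(p, q)`; the proof is that of
`transversal_of_resultantKernel` (item 19180) with the global hypothesis replaced by its only use. -/
theorem transversal_layout_of_resultantKernel_layout
    (h r : ℕ) (u w : Fin r → Finset (Fin h))
    (hCTc : ∃ p q : Fin (h + h) → ℂ, (Matrix.of fun i j : Fin r =>
        ∏ a : Fin h, ∏ c : Fin h, (p (if a ∈ u i then Fin.castAdd h a else Fin.natAdd h a)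
          - q (if c ∈ (w j)ᶜ then Fin.natAdd h c else Fin.castAdd h c))).det ≠ 0) :
    ∃ H : Matrix (Fin (h + h)) (Fin (h + h)) ℂ, (Matrix.of fun i j : Fin r =>
      (H.submatrix (fun a : Fin h => if a ∈ u i then Fin.castAdd h a else Fin.natAdd h a)
        (fun c : Fin h => if c ∈ w j then Fin.natAdd h c else Fin.castAdd h c)).det).det ≠ 0 := by
  classical
  -- Step 1: CT for the complemented layout `(u, wᶜ)`, as a nonzero polynomial in `(p, q)`
  obtain ⟨p₀, q₀, h0⟩ := hCTc
  set G : MvPolynomial (Fin (h + h) ⊕ Fin (h + h)) ℂ := (Matrix.of fun i j : Fin r =>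
      ∏ a : Fin h, ∏ c : Fin h,
        (X (Sum.inl (if a ∈ u i then Fin.castAdd h a else Fin.natAdd h a))
          - X (Sum.inr (if c ∈ (w j)ᶜ then Fin.natAdd h c else Fin.castAdd h c)) :
            MvPolynomial (Fin (h + h) ⊕ Fin (h + h)) ℂ)).det with hG
  have hevalG : ∀ v : Fin (h + h) ⊕ Fin (h + h) → ℂ, eval v G = (Matrix.of fun i j : Fin r =>
      ∏ a : Fin h, ∏ c : Fin h,
        (v (Sum.inl (if a ∈ u i then Fin.castAdd h a else Fin.natAdd h a))
          - v (Sum.inr (if c ∈ (w j)ᶜ then Fin.natAdd h c else Fin.castAdd h c)))).det := by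
    intro v
    rw [hG, RingHom.map_det]
    congr 1
    ext i j
    simp only [RingHom.mapMatrix_apply, Matrix.map_apply, Matrix.of_apply, map_prod, map_sub,
      eval_X]
  have hG0 : G ≠ 0 := by
    intro hz
    apply h0
    have h1 := hevalG (Sum.elim p₀ q₀)
    rw [hz, map_zero] at h1
    simp only [Sum.elim_inl, Sum.elim_inr] at h1
    exact h1.symm
  obtain ⟨v, hvinj, hvG⟩ := exists_injective_eval_ne_zero hG0
  rw [hevalG] at hvG
  -- the generic parameters: all `p_i, q_j` distinct
  set p : Fin (h + h) → ℂ := fun i => v (Sum.inl i) with hp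
  set q : Fin (h + h) → ℂ := fun j => v (Sum.inr j) with hq
  have hpq : ∀ i j, p i ≠ q j := fun i j hij => Sum.inl_ne_inr (hvinj hij)
  have hpinj : Function.Injective p := fun i i' h' => Sum.inl_injective (hvinj h')
  have hqinj : Function.Injective q := fun j j' h' => Sum.inr_injective (hvinj h')
  -- Step 2: the Cauchy matrix at `(p, q)`
  refine ⟨Matrix.of fun i j : Fin (h + h) => (p i - q j)⁻¹, ?_⟩
  obtain ⟨V, V', hV, hV', hdet⟩ := det_cauchy_submatrix_eq p q hpq
  -- abbreviations: row factors, column factors, the CT matrix of the complemented layout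
  set d₁ : Fin r → ℂ := fun i =>
    V (fun a : Fin h => if a ∈ u i then Fin.castAdd h a else Fin.natAdd h a) /
      ∏ a : Fin h, ∏ jj : Fin (h + h),
        (p (if a ∈ u i then Fin.castAdd h a else Fin.natAdd h a) - q jj) with hd₁
  set d₂ : Fin r → ℂ := fun j =>
    V' (fun c : Fin h => if c ∈ w j then Fin.natAdd h c else Fin.castAdd h c) with hd₂
  set Mc : Fin r → Fin r → ℂ := fun i j =>
    ∏ a : Fin h, ∏ c : Fin h, (p (if a ∈ u i then Fin.castAdd h a else Fin.natAdd h a)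
      - q (if c ∈ (w j)ᶜ then Fin.natAdd h c else Fin.castAdd h c)) with hMc
  -- Step 3: entrywise, `det H[ρ_{u_i}, τ_{w_j}] = d₁ i * (Mc i j * d₂ j)`
  have hentry : ∀ i j : Fin r,
      ((Matrix.of fun i j : Fin (h + h) => (p i - q j)⁻¹).submatrix
          (fun a : Fin h => if a ∈ u i then Fin.castAdd h a else Fin.natAdd h a)
          (fun c : Fin h => if c ∈ w j then Fin.natAdd h c else Fin.castAdd h c)).det
        = d₁ i * (Mc i j * d₂ j) := by
    intro i j
    rw [hdet]
    have hR : (∏ a : Fin h, ∏ c : Fin h, (p (if a ∈ u i then Fin.castAdd h a else Fin.natAdd h a)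
          - q (if c ∈ w j then Fin.natAdd h c else Fin.castAdd h c))) * Mc i j
        = ∏ a : Fin h, ∏ jj : Fin (h + h),
            (p (if a ∈ u i then Fin.castAdd h a else Fin.natAdd h a) - q jj) := by
      rw [hMc, ← Finset.prod_mul_distrib]
      exact Finset.prod_congr rfl fun a _ => prod_pair_compl h (w j)
        (fun jj => p (if a ∈ u i then Fin.castAdd h a else Fin.natAdd h a) - q jj)
    have hR0 : ∏ a : Fin h, ∏ jj : Fin (h + h),
        (p (if a ∈ u i then Fin.castAdd h a else Fin.natAdd h a) - q jj) ≠ 0 :=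
      Finset.prod_ne_zero_iff.2 fun a _ => Finset.prod_ne_zero_iff.2 fun jj _ =>
        sub_ne_zero.2 (hpq _ _)
    have hD0 : ∏ a : Fin h, ∏ c : Fin h, (p (if a ∈ u i then Fin.castAdd h a else Fin.natAdd h a)
          - q (if c ∈ w j then Fin.natAdd h c else Fin.castAdd h c)) ≠ 0 :=
      Finset.prod_ne_zero_iff.2 fun a _ => Finset.prod_ne_zero_iff.2 fun c _ =>
        sub_ne_zero.2 (hpq _ _)
    have hMc0 : Mc i j ≠ 0 := by
      intro hz
      rw [hz, mul_zero] at hR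
      exact hR0 hR.symm
    rw [hd₁, hd₂]
    simp only
    rw [← hR]
    field_simp
  -- Step 4: the layout determinant factors
  have hmat : (Matrix.of fun i j : Fin r =>
      ((Matrix.of fun i j : Fin (h + h) => (p i - q j)⁻¹).submatrix
          (fun a : Fin h => if a ∈ u i then Fin.castAdd h a else Fin.natAdd h a)
          (fun c : Fin h => if c ∈ w j then Fin.natAdd h c else Fin.castAdd h c)).det)
      = Matrix.of fun i j : Fin r => d₁ i * (Mc i j * d₂ j) := by
    ext i j
    exact hentry i j
  have h1 : (Matrix.of fun i j : Fin r => d₁ i * (Mc i j * d₂ j)).det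
      = (∏ i, d₁ i) * (Matrix.of fun i j : Fin r => Mc i j * d₂ j).det :=
    Matrix.det_mul_column d₁ (Matrix.of fun i j : Fin r => Mc i j * d₂ j)
  have h2 : (Matrix.of fun i j : Fin r => Mc i j * d₂ j).det
      = (∏ j, d₂ j) * (Matrix.of fun i j : Fin r => Mc i j).det := by
    rw [← Matrix.det_mul_row d₂ (Matrix.of fun i j : Fin r => Mc i j)]
    congr 1
    ext i j
    simp only [Matrix.of_apply, mul_comm]
  rw [hmat, h1, h2]
  have hd₁0 : ∀ i, d₁ i ≠ 0 := fun i =>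
    div_ne_zero (hV _ (rowT_injective h (u i)) hpinj)
      (Finset.prod_ne_zero_iff.2 fun a _ => Finset.prod_ne_zero_iff.2 fun jj _ =>
        sub_ne_zero.2 (hpq _ _))
  have hd₂0 : ∀ j, d₂ j ≠ 0 := fun j => hV' _ (colT_injective h (w j)) hqinj
  refine mul_ne_zero (Finset.prod_ne_zero_iff.2 fun i _ => hd₁0 i)
    (mul_ne_zero (Finset.prod_ne_zero_iff.2 fun j _ => hd₂0 j) ?_)
  exact hvG

/-! ## 2. Height slices -/

/-- **CT at height `h` (all `r`, all injective layout pairs) ⇒ TT at height `h`.** -/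
theorem transversal_slice_of_resultantKernel_slice (h : ℕ)
    (hCT : ∀ (r : ℕ) (u w : Fin r → Finset (Fin h)), Function.Injective u →
      Function.Injective w → ∃ p q : Fin (h + h) → ℂ, (Matrix.of fun i j : Fin r =>
        ∏ a : Fin h, ∏ c : Fin h, (p (if a ∈ u i then Fin.castAdd h a else Fin.natAdd h a)
          - q (if c ∈ w j then Fin.natAdd h c else Fin.castAdd h c))).det ≠ 0)
    (r : ℕ) (u w : Fin r → Finset (Fin h)) (hu : Function.Injective u)
    (hw : Function.Injective w) :
    ∃ H : Matrix (Fin (h + h)) (Fin (h + h)) ℂ, (Matrix.of fun i j : Fin r =>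
      (H.submatrix (fun a : Fin h => if a ∈ u i then Fin.castAdd h a else Fin.natAdd h a)
        (fun c : Fin h => if c ∈ w j then Fin.natAdd h c else Fin.castAdd h c)).det).det ≠ 0 := by
  have hwc : Function.Injective (fun j => (w j)ᶜ) := fun j j' hjj' => hw (compl_injective hjj')
  exact transversal_layout_of_resultantKernel_layout h r u w (hCT r u (fun j => (w j)ᶜ) hu hwc)

/-- **One valuation certificate for a whole height ⇒ TT at that height.** If polynomial literal
parameters `pP qP : Fin (h+h) → ℂ[X]` with exact cross valuations `d` (`pP i - qP k = X^{d i k}·g`,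
`g(0) ≠ 0`) make the assignment problem of EVERY pair of injective layouts at height `h` uniquely
solvable, then every transversal layout matrix at height `h` is nonsingular for some `H`. -/
theorem transversal_slice_of_universal_valuation
    (h : ℕ) (pP qP : Fin (h + h) → Polynomial ℂ) (d : Fin (h + h) → Fin (h + h) → ℕ)
    (g : Fin (h + h) → Fin (h + h) → Polynomial ℂ)
    (hfac : ∀ i k, pP i - qP k = Polynomial.X ^ d i k * g i k)
    (hg0 : ∀ i k, (g i k).eval 0 ≠ 0)
    (huniv : ∀ (r : ℕ) (u w : Fin r → Finset (Fin h)), Function.Injective u →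
      Function.Injective w → ∃ π₀ : Equiv.Perm (Fin r), ∀ σ : Equiv.Perm (Fin r), σ ≠ π₀ →
        (∑ j, ∑ a : Fin h, ∑ c : Fin h,
          d (if a ∈ u (π₀ j) then Fin.castAdd h a else Fin.natAdd h a)
            (if c ∈ w j then Fin.natAdd h c else Fin.castAdd h c)) <
        (∑ j, ∑ a : Fin h, ∑ c : Fin h,
          d (if a ∈ u (σ j) then Fin.castAdd h a else Fin.natAdd h a)
            (if c ∈ w j then Fin.natAdd h c else Fin.castAdd h c)))
    (r : ℕ) (u w : Fin r → Finset (Fin h)) (hu : Function.Injective u)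
    (hw : Function.Injective w) :
    ∃ H : Matrix (Fin (h + h)) (Fin (h + h)) ℂ, (Matrix.of fun i j : Fin r =>
      (H.submatrix (fun a : Fin h => if a ∈ u i then Fin.castAdd h a else Fin.natAdd h a)
        (fun c : Fin h => if c ∈ w j then Fin.natAdd h c else Fin.castAdd h c)).det).det ≠ 0 :=
  transversal_slice_of_resultantKernel_slice h
    (resultantKernel_slice_of_universal_valuation h pP qP d g hfac hg0 huniv) r u w hu hw

/-- **The irreducible-core slice (binder shape of item 19616, stmt-ValiantsHypothesis-19616) from a
universal valuation certificate at height `h + 1`.** The R1/R2-irreducibility hypotheses of the item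
are carried but not used: a universal certificate gives the whole TT slice. -/
theorem irreducibleCore_slice_of_universal_valuation
    (h : ℕ) (pP qP : Fin ((h + 1) + (h + 1)) → Polynomial ℂ)
    (d : Fin ((h + 1) + (h + 1)) → Fin ((h + 1) + (h + 1)) → ℕ)
    (g : Fin ((h + 1) + (h + 1)) → Fin ((h + 1) + (h + 1)) → Polynomial ℂ)
    (hfac : ∀ i k, pP i - qP k = Polynomial.X ^ d i k * g i k)
    (hg0 : ∀ i k, (g i k).eval 0 ≠ 0)
    (huniv : ∀ (r : ℕ) (u w : Fin r → Finset (Fin (h + 1))), Function.Injective u →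
      Function.Injective w → ∃ π₀ : Equiv.Perm (Fin r), ∀ σ : Equiv.Perm (Fin r), σ ≠ π₀ →
        (∑ j, ∑ a : Fin (h + 1), ∑ c : Fin (h + 1),
          d (if a ∈ u (π₀ j) then Fin.castAdd (h + 1) a else Fin.natAdd (h + 1) a)
            (if c ∈ w j then Fin.natAdd (h + 1) c else Fin.castAdd (h + 1) c)) <
        (∑ j, ∑ a : Fin (h + 1), ∑ c : Fin (h + 1),
          d (if a ∈ u (σ j) then Fin.castAdd (h + 1) a else Fin.natAdd (h + 1) a)
            (if c ∈ w j then Fin.natAdd (h + 1) c else Fin.castAdd (h + 1) c))) :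
    ∀ (r : ℕ) (u w : Fin r → Finset (Fin (h + 1))), Function.Injective u → Function.Injective w →
      (∀ (a c : Fin (h + 1)) (β γ : Bool),
        (Finset.univ.filter fun i : Fin r => (a ∈ u i ↔ β = true)).card ≠
          (Finset.univ.filter fun j : Fin r => (c ∈ w j ↔ γ = true)).card) →
      (∀ (a c : Fin (h + 1)),
        Function.Injective (fun i => Finset.univ.filter fun b : Fin h => a.succAbove b ∈ u i) →
        Function.Injective (fun j => Finset.univ.filter fun b : Fin h => c.succAbove b ∈ w j) →
          False) →
      ∃ H : Matrix (Fin ((h + 1) + (h + 1))) (Fin ((h + 1) + (h + 1))) ℂ,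
        (Matrix.of fun i j : Fin r => (H.submatrix
          (fun b : Fin (h + 1) => if b ∈ u i then Fin.castAdd (h + 1) b else Fin.natAdd (h + 1) b)
          (fun b : Fin (h + 1) => if b ∈ w j then Fin.natAdd (h + 1) b
            else Fin.castAdd (h + 1) b)).det).det ≠ 0 :=
  fun r u w hu hw _ _ =>
    transversal_slice_of_universal_valuation (h + 1) pP qP d g hfac hg0 huniv r u w hu hw

end Summit.ValiantsHypothesis.ValiantsHypothesis.Theorems.BarrierLever.ResultantKernel
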